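import Summits.BirchSwinnertonDyer.BirchSwinnertonDyer.Theorems.AlignedTransportAtTwoBSDOfMainConjectureRankOneAtTwoOrderTransfer
import Literature.NumberTheory.EllipticCurves.KatoRankBoundLevelZeroProofs
import Literature.NumberTheory.EllipticCurves.GrossZagierRationalPoint
import HarnessLib

/-!
# Route `AlignedTransportAtTwo`, crux C3′ `BSDOfMainConjectureRankOneAtTwo` (stmt-BirchSwinnertonDyer-23008): what the
# SIMPLE-ZERO binder `ord_T L₂(f_E, T) = 1` says on the cell — exactly `L₂′(0) ≠ 0` — and the zero itself is automatic

HONEST FRAMING (cell `bsd-f1-sign2`, prover seat `bsd-line-att-p3`; BSD is NOT proved by any of this; THEOREMS ONLY, nothing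
asserted, no definition). Companion of `…OrderTransfer.lean` (stub O of line `birth`). By the Mazur–Swinnerton-Dyer
interpolation at `T = 0` (tree THEOREM `one_le_order_padicLFunction_iff`: at a good ordinary `p`, `1 ≤ ord_T L_p(f_E, α)
↔ L(E,1) = 0`) and `L(E,1) = 0` in analytic rank one (`entireLFunction_one_eq_zero_of_analyticRank_eq_one`), the
`p`-adic `L`-function of a cell curve ALWAYS vanishes at `T = 0`; so the crux's hypothesis `order = 1` is exactly the
non-vanishing of the `T¹`-coefficient (`L₂′(0) ≠ 0`, the `2`-adic regulator condition the vet called "expected but not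
numerically certified"), and through Mazur's main conjecture (stub O's transfer) the ALGEBRAIC zero `1 ≤ ord_T g` of the
characteristic generator is likewise automatic modulo modularity. Any prime `p` of good ordinary reduction throughout;
the `p = 2` cell statements are the last two theorems.

* `order_eq_one_iff_coeff_one_ne_zero_of_one_le_order` — power-series bookkeeping: `1 ≤ ord φ → (ord φ = 1 ↔ [T¹]φ ≠ 0)`.
* `one_le_order_padicLFunction_of_analyticRank_eq_one` / `order_padicLFunction_eq_one_iff_coeff_one_ne_zero` — any good
  ordinary `p`, any newform `f` of `W`, `r_an = 1`.
* `isTorsion_and_exists_charGenerator_one_le_order_of_analyticRank_eq_one` — MC_p + modularity + `r_an = 1` ⟹ every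
  cyclotomic dual datum is torsion with `char X = (g)`, `1 ≤ ord_T g`.
* `simpleZeroAtTwo_iff_coeff_one_ne_zero` — on the C3′ cell the binder
  `∀ f (conductor level), IsNewformOf W f → ord_T L₂(f, α) = 1` ⟺ `∀ f, IsNewformOf W f → [T¹] L₂(f, α) ≠ 0`.

References: B. Mazur, J. Tate, J. Teitelbaum, Invent. Math. 84 (1986) §I.14; R. Greenberg, LNM 1716 (1999) §4 p. 111;
F. Castella, G. Grossi, C. Skinner, Math. Ann. 393 (2025), Introduction (MC).
-/

set_option autoImplicit false
-- the route's Theorems namespace repeats a component by design (summit = sub-problem, D-0017).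
set_option linter.dupNamespace false

noncomputable section

open scoped Classical MatrixGroups ModularForm

open CongruenceSubgroup WeierstrassCurve Literature.NumberTheory.EllipticCurves
  Literature.NumberTheory.EllipticCurves.ModularForms
  Literature.NumberTheory.EllipticCurves.Greenberg1999
  Summit.BirchSwinnertonDyer.BirchSwinnertonDyer.Theorems.Rank1ResidualX1Defs

namespace Summit.BirchSwinnertonDyer.BirchSwinnertonDyer.Theorems.AlignedTransportAtTwoOrderTransfer

/-! ## §1 Power-series bookkeeping -/

/-- For a formal power series with `1 ≤ ord φ` (no constant term): `ord φ = 1 ↔ [T¹]φ ≠ 0`. [folklore] -/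
theorem order_eq_one_iff_coeff_one_ne_zero_of_one_le_order {R : Type*} [Semiring R] {φ : PowerSeries R}
    (h1 : 1 ≤ φ.order) : φ.order = 1 ↔ PowerSeries.coeff 1 φ ≠ 0 := by
  have h1' : ((1 : ℕ) : ℕ∞) = 1 := rfl
  rw [← h1', PowerSeries.order_eq_nat]
  refine ⟨fun h => h.1, fun h => ⟨h, fun i hi => ?_⟩⟩
  have hi0 : i = 0 := by omega
  subst hi0
  exact PowerSeries.coeff_of_lt_order 0 (lt_of_lt_of_le (by exact_mod_cast zero_lt_one) h1)

/-! ## §2 Any good ordinary prime: the analytic zero at `T = 0` in analytic rank one -/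

section AnyPrime

variable (W : WeierstrassCurve ℚ) [W.IsElliptic] [W.IsGloballyMinimal] (p : ℕ) [Fact p.Prime]

/-- **`L_p(E, 0) = 0` in analytic rank one.** At a good ordinary `p`, for every newform `f` of `W` (any level):
`ord_{s=1} L(E,s) = 1 ⟹ 1 ≤ ord_{T=0} L_p(f, α, T)` — interpolation `L_p(f,α)(0) = (1 − α⁻¹)² L(E,1)/Ω⁺_f`
(`one_le_order_padicLFunction_iff`) and `L(E,1) = 0`. [cite: MazurTateTeitelbaum1986Invent, §I.14] -/
theorem one_le_order_padicLFunction_of_analyticRank_eq_one (hord : IsOrdinaryAt W p) {N : ℕ} [NeZero N]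
    {f : CuspForm (Gamma0 N) 2} (hf : IsNewformOf W f) (hr : W.analyticRank = 1) :
    1 ≤ (padicLFunction f (unitRoot W p : ℚ_[p])).order :=
  (one_le_order_padicLFunction_iff W p hord hf).mpr (entireLFunction_one_eq_zero_of_analyticRank_eq_one hr)

/-- **The simple-zero condition is `L_p′(0) ≠ 0` in analytic rank one**: at a good ordinary `p`, for every newform `f`
of `W`, `ord_{T=0} L_p(f, α, T) = 1 ↔ [T¹] L_p(f, α, T) ≠ 0`. [cite: MazurTateTeitelbaum1986Invent, §I.14]
[cite: GreenbergLNM1716, §4 p. 111] -/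
theorem order_padicLFunction_eq_one_iff_coeff_one_ne_zero (hord : IsOrdinaryAt W p) {N : ℕ} [NeZero N]
    {f : CuspForm (Gamma0 N) 2} (hf : IsNewformOf W f) (hr : W.analyticRank = 1) :
    (padicLFunction f (unitRoot W p : ℚ_[p])).order = 1 ↔
      PowerSeries.coeff 1 (padicLFunction f (unitRoot W p : ℚ_[p])) ≠ 0 :=
  order_eq_one_iff_coeff_one_ne_zero_of_one_le_order
    (one_le_order_padicLFunction_of_analyticRank_eq_one W p hord hf hr)

/-- **The ALGEBRAIC zero is automatic (modulo modularity) under the main conjecture**: at a good ordinary `p`, for `W` of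
analytic rank one, `MazurMainConjecture W p` + modularity ⟹ every cyclotomic Selmer-dual datum is `Λ`-torsion with
`char X = (g)` and `1 ≤ ord_T g` (order transfer of `…OrderTransfer.lean` + the analytic zero above). So of C3′'s binder
`ord_T = 1` only the upper half `ord_T ≤ 1` carries information. [cite: CastellaGrossiSkinner2025, Introduction (MC)]
[cite: MazurTateTeitelbaum1986Invent, §I.14] -/
theorem isTorsion_and_exists_charGenerator_one_le_order_of_analyticRank_eq_one
    (hmod : nonempty_modularParametrizationData) (hord : IsOrdinaryAt W p) (hr : W.analyticRank = 1)
    (hMC : MazurMainConjecture W p)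
    {κ : ZpExtension ℚ p} {γ : Field.absoluteGaloisGroup ℚ}
    (hκ : κ.IsCyclotomic) (hγ : κ.IsTopGenerator γ) (hγ' : IsCyclotomicVariable p γ)
    (D : W.SelmerDualData κ γ) :
    D.IsTorsion ∧ ∃ g : IwasawaAlgebra p, D.charIdeal = Ideal.span {g} ∧ 1 ≤ g.order := by
  haveI : NeZero (W.conductorNorm ℤ) := ⟨(W.conductorNorm_pos_holds).ne'⟩
  obtain ⟨Dm⟩ := hmod W
  obtain ⟨hX, g, hchar, hord'⟩ :=
    isTorsion_and_exists_charGenerator_order_eq_of_mazurMainConjecture W p Dm hMC hκ hγ hγ' D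
  exact ⟨hX, g, hchar, hord' ▸ one_le_order_padicLFunction_of_analyticRank_eq_one W p hord Dm.isNewformOf hr⟩

end AnyPrime

/-! ## §3 The C3′ cell at `p = 2` -/

/-- **On the C3′ cell the simple-zero binder is exactly `L₂′(0) ≠ 0`.** For `W` good ordinary at `2` of analytic rank one,
`(∀ f at level N_E, IsNewformOf W f → ord_T L₂(f, α) = 1) ↔ (∀ f at level N_E, IsNewformOf W f → [T¹] L₂(f, α) ≠ 0)` —
the hypothesis of crux C3′ (stmt-BirchSwinnertonDyer-23008) restated as the non-vanishing of one `2`-adic number (per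
curve a finite `2`-adic computation once `f_E` is known; not certified in the tree). [cite: MazurTateTeitelbaum1986Invent, §I.14] -/
theorem simpleZeroAtTwo_iff_coeff_one_ne_zero (W : WeierstrassCurve ℚ) [W.IsElliptic] [W.IsGloballyMinimal]
    (hord : IsOrdinaryAt W 2) (hr : W.analyticRank = 1) :
    (∀ [NeZero (W.conductorNorm ℤ)] (f : CuspForm (Gamma0 (W.conductorNorm ℤ)) 2), IsNewformOf W f →
        (padicLFunction f (unitRoot W 2 : ℚ_[2])).order = 1) ↔
      (∀ [NeZero (W.conductorNorm ℤ)] (f : CuspForm (Gamma0 (W.conductorNorm ℤ)) 2), IsNewformOf W f →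
        PowerSeries.coeff 1 (padicLFunction f (unitRoot W 2 : ℚ_[2])) ≠ 0) := by
  refine ⟨fun h _ f hf => ?_, fun h _ f hf => ?_⟩
  · exact (order_padicLFunction_eq_one_iff_coeff_one_ne_zero W 2 hord hf hr).mp (h f hf)
  · exact (order_padicLFunction_eq_one_iff_coeff_one_ne_zero W 2 hord hf hr).mpr (h f hf)

/-- **Stub O's conclusion with the binder in the `L₂′(0) ≠ 0` form** (modularity only): on the C3′ cell, if every
conductor-level newform `f` of `W` has `[T¹] L₂(f, α) ≠ 0`, then Mazur's `2`-adic main conjecture makes every cyclotomic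
Selmer-dual datum torsion with a characteristic generator of order exactly `1`.
[cite: CastellaGrossiSkinner2025, Introduction (MC)] [cite: MazurTateTeitelbaum1986Invent, §I.14] -/
theorem algebraicSimpleZeroAtTwo_of_coeff_one_ne_zero (hmod : nonempty_modularParametrizationData)
    (W : WeierstrassCurve ℚ) [W.IsElliptic] [W.IsGloballyMinimal] (hord : IsOrdinaryAt W 2)
    (hr : W.analyticRank = 1)
    (h1 : ∀ [NeZero (W.conductorNorm ℤ)] (f : CuspForm (Gamma0 (W.conductorNorm ℤ)) 2), IsNewformOf W f →
        PowerSeries.coeff 1 (padicLFunction f (unitRoot W 2 : ℚ_[2])) ≠ 0)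
    (hMC : MazurMainConjecture W 2)
    {κ : ZpExtension ℚ 2} {γ : Field.absoluteGaloisGroup ℚ}
    (hκ : κ.IsCyclotomic) (hγ : κ.IsTopGenerator γ) (hγ' : IsCyclotomicVariable 2 γ)
    (D : W.SelmerDualData κ γ) :
    D.IsTorsion ∧ ∃ g : IwasawaAlgebra 2, D.charIdeal = Ideal.span {g} ∧ g.order = 1 :=
  isTorsion_and_exists_charGenerator_order_eq_of_order_padicLFunction_eq W 2 hmod
    ((simpleZeroAtTwo_iff_coeff_one_ne_zero W hord hr).mpr h1) hMC hκ hγ hγ' D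

end Summit.BirchSwinnertonDyer.BirchSwinnertonDyer.Theorems.AlignedTransportAtTwoOrderTransfer

end
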